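import Literature.AlgebraicGeometry.Modules.PushforwardIsoContract
import Literature.AlgebraicGeometry.HodgeTheory.TwistJetPushforwardIso
import Literature.AlgebraicGeometry.HodgeTheory.AtiyahClassTraceNaturality
import Literature.AlgebraicGeometry.HodgeTheory.SemiregularVariationalHodgeISemiregularModel
import Literature.AlgebraicGeometry.Modules.ExtCohomologyComparison
import Literature.AlgebraicGeometry.Modules.ModulesGrothendieckAbelian
import Literature.AlgebraicGeometry.Motives.LinearCohomologyAbComparison
import Literature.AlgebraicGeometry.Motives.ExtMapExactFunctor
import HarnessLib

/-!
# Buchweitz–Flenner `I`-semiregularity is invariant under an isomorphism of the ambient scheme;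
# Thm. 5.1's model rendering follows from the fixed-fibre rendering

Layer `Literature/AlgebraicGeometry/HodgeTheory`. THEOREMS ONLY (no definition, no named fact; D-0026).
For an isomorphism `e : X₀ ≅ X₁` of `S`-schemes and a finite locally free `E` on `X₀`:

* `mk₀_comp_mapExactFunctor_traceExtCoeff` — the trace with coefficients
  `Tr_G : Extⁱ(E, 𝓗om(E^∨, G)) → Extⁱ(𝒪, G)` (`AtiyahClassTraceReal.lean`) commutes with `e_*`
  (unit, `𝓗om(E, –)`, contraction: `Modules/PushforwardIsoUnit`, `Modules/PushforwardIsoContract`);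
* `sigmaHigher_mapExactFunctor_eq_zero_iff` — `σ_q^{e_*E}(e_* x) = 0 ↔ σ_q^{E}(x) = 0`
  (`HodgeTheory/TwistJetPushforwardIso`: `ι`, the Atiyah powers and the twists along `e_*`; Hartshorne
  III.6.3 (c) `extToCohomology_bijective` to drop from cohomology to `Ext`; no cohomological base change
  is needed);
* **`IsISemiregular.of_schemeIso`** — `IsISemiregular hE J → IsISemiregular (hE.pushforward_of_iso _) J`
  for `e_* E` and every set `J` of form degrees: the functoriality in `X` that
  `SemiregularityHigherSigma.lean` records as «Not here»; the cell file
  `lit/LEAN-MAP-Bloch1972-BF2003.md` ADDENDUM 3 of `pub-hsemireg` sized this obligation «(t-σ)»;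
* **`BuchweitzFlenner2003_variationalHodge_ISemiregular_model_of_fixed`** and `…_model_iff` — the MODEL
  rendering of Buchweitz–Flenner Thm. 5.1 (`SemiregularVariationalHodgeISemiregularModel.lean`, which
  records «NOT proved: the converse implication (fixed-fibre ⟹ model rendering)») FOLLOWS from the
  fixed-fibre rendering `BuchweitzFlenner2003_variationalHodge_ISemiregular`: push the seed `ℰ_0` forward
  along the model isomorphism (finite locally free, `I`-semiregular there by `of_schemeIso`,
  `ch_p(e_*ℰ_0) = (e⁻¹)^* ch_p(ℰ_0)` by `ChernCharacterBetti.map_ch`/`ch_congr`). The two renderings are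
  therefore EQUIVALENT; Thm. 5.1 itself remains a named fact.

Motivation: venture HSemireg (cell `pub-hsemireg`), bridge (B1) «VHC-instance ⇒ whole-component
algebraicity», sheaf door: its two named facts (fixed-fibre / model rendering of Thm. 5.1) become one.

References: R.-O. Buchweitz, H. Flenner, *A semiregularity map for modules and applications to
deformations*, Compositio Math. 137 (2003): §4 Def. 4.1 (σ), the trace map; §5 («`ℰ_0` is called
`I`-semiregular if the part `σ_I` … is injective»), Thm. 5.1 [BuchweitzFlenner2003]; R. Hartshorne,
*Algebraic Geometry* (1977), III Prop. 6.3 (c) [Hartshorne1977]; W. Fulton, *Intersection Theory* (1998),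
§15.1 (ii) (`ch ∘ f^* = f^* ∘ ch`) [Fulton1998].
-/

noncomputable section

-- `TopCat.Presheaf`/`Scheme.Modules` are not reducible (as in Mathlib's `AlgebraicGeometry/Modules/Sheaf.lean`).
set_option backward.isDefEq.respectTransparency false

open CategoryTheory CategoryTheory.Limits CategoryTheory.Abelian AlgebraicGeometry Opposite TopologicalSpace
open AlgebraicGeometry.Scheme.Modules

universe u w

namespace Literature.AlgebraicGeometry.HodgeTheory

open Literature.AlgebraicGeometry.Modules Literature.AlgebraicGeometry.Motives

/-! ### The trace with coefficients on `Ext` along `ε_*` -/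

section TraceExt

open Literature.AlgebraicGeometry.HodgeTheory

variable {Y₀ Y₁ : Scheme.{u}} (ε : Y₀ ≅ Y₁) {E : Y₀.Modules} (hE : IsFiniteLocallyFree E) (G : Y₀.Modules)
variable [HasExt.{w} Y₀.Modules] [HasExt.{w} Y₁.Modules]

/-- **`Tr` commutes with `ε_*` on `Ext`**: `ε♯ · ε_*(Tr_G^E(y)) = Tr_{ε_*G}^{ε_*E}(ε_*(y) · γ)`, `γ` the comparison
`ε_*𝓗om(E^∨, G) ≅ 𝓗om((ε_*E)^∨, ε_*G)`: the unit, `𝓗om(E, –)` and the contraction all commute with `ε_*`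
(`PushforwardIsoUnit`, `PushforwardIsoContract`), and `Ext.mapExactFunctor` is functorial in the exact functor
(`Motives/ExtMapExactFunctor`). [cite: BuchweitzFlenner2003, §4 (the trace map Tr : Ext^k(F, F ⊗ G) → H^k(X, G), «see [Ill]»; reading: its compatibility with an isomorphism of the ambient scheme)] -/
theorem mk₀_comp_mapExactFunctor_traceExtCoeff (i : ℕ) (y : Ext.{w} E (sheafHom (dual E) G) i) :
    (Ext.mk₀ (unitPushforwardIso ε).hom).comp
        ((traceExtCoeff hE G i y).mapExactFunctor (pushforward ε.hom)) (zero_add i) =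
      traceExtCoeff (hE.pushforward_of_iso ε) ((pushforward ε.hom).obj G) i
        ((y.mapExactFunctor (pushforward ε.hom)).comp
          (Ext.mk₀ (sheafHomDualPushforwardIso ε E G).hom) (add_zero i)) := by
  haveI := preservesFiniteColimits_sheafHomFunctor E hE
  haveI := preservesFiniteColimits_sheafHomFunctor _ (hE.pushforward_of_iso ε)
  -- `ε_*(𝓗om(E,–)(y)) = κ_E · 𝓗om(ε_*E,–)(ε_* y) · κ⁻¹`
  have hfun : (y.mapExactFunctor (sheafHomFunctor E)).mapExactFunctor (pushforward ε.hom) =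
      (Ext.mk₀ (sheafHomPushforwardIso ε E E).hom).comp
        (((y.mapExactFunctor (pushforward ε.hom)).mapExactFunctor
            (sheafHomFunctor ((pushforward ε.hom).obj E))).comp
          (Ext.mk₀ (sheafHomPushforwardIso ε E (sheafHom (dual E) G)).inv) (add_zero i)) (zero_add i) := by
    rw [← Ext.mapExactFunctor_functorComp, ← Ext.mapExactFunctor_functorComp,
      ← Ext.mapExactFunctor_functorIso (sheafHomFunctorCompPushforwardIso ε E).symm y]
    rfl
  rw [traceExtCoeff_apply, traceExtCoeff_apply, Ext.mapExactFunctor_comp, Ext.mapExactFunctor_comp,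
    Ext.mapExactFunctor_mk₀, Ext.mapExactFunctor_mk₀, hfun, pushforward_map_contract ε hE G,
    Ext.mapExactFunctor_comp, Ext.mapExactFunctor_mk₀, ← unitPushforwardIso_hom_comp_map_sheafHomUnit ε E]
  simp only [Ext.comp_assoc_of_third_deg_zero, Ext.mk₀_comp_mk₀, Ext.mk₀_comp_mk₀_assoc,
    Iso.inv_hom_id_assoc, sheafHomFunctor_map]

end TraceExt

variable {S : Type u} [CommRing S] {X₀ X₁ : Over (Spec (CommRingCat.of S))} (e : X₀ ≅ X₁)

/-- Post-composition with an isomorphism detects `0` in `Ext`. [folklore] -/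
private theorem Ext.comp_mk₀_eq_zero_iff {C : Type*} [Category C] [Abelian C] [HasExt.{w} C]
    {A B B' : C} {n : ℕ} (z : Ext A B n) (i : B ≅ B') :
    z.comp (Ext.mk₀ i.hom) (add_zero n) = 0 ↔ z = 0 := by
  refine ⟨fun h => ?_, fun h => by rw [h, Ext.zero_comp]⟩
  have h' := congrArg (fun w => w.comp (Ext.mk₀ i.inv) (add_zero n)) h
  simpa only [Ext.comp_assoc_of_third_deg_zero, Ext.mk₀_comp_mk₀, Iso.hom_inv_id, Ext.comp_mk₀_id,
    Ext.zero_comp] using h'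

/-- Pre-composition with an isomorphism detects `0` in `Ext`. [folklore] -/
private theorem Ext.mk₀_comp_eq_zero_iff {C : Type*} [Category C] [Abelian C] [HasExt.{w} C]
    {A A' B : C} {n : ℕ} (i : A' ≅ A) (z : Ext A B n) :
    (Ext.mk₀ i.hom).comp z (zero_add n) = 0 ↔ z = 0 := by
  refine ⟨fun h => ?_, fun h => by rw [h, Ext.comp_zero]⟩
  have h' := congrArg (fun w => (Ext.mk₀ i.inv).comp w (zero_add n)) h
  simpa only [Ext.mk₀_comp_mk₀_assoc, Iso.inv_hom_id, Ext.mk₀_id_comp, Ext.comp_zero] using h'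

/-! ### `σ_q` and `I`-semiregularity along an isomorphism of `S`-schemes -/

section Assembly

variable {E : X₀.left.Modules} (hE : IsFiniteLocallyFree E)
variable [HasExt.{w} X₀.left.Modules] [HasExt.{w} X₁.left.Modules]

/-- **`σ_q` along `e_*`**: `σ_q^{e_*E}(e_* x) = 0 ↔ σ_q^{E}(x) = 0` for every `x ∈ Ext²(E, E)`. Proof:
`e_*((x·ι)·At^q) = ((e_*x·ι')·At'^q)·α_q⁻¹` (`map_toTwistHodgeZero_comp`, `mapExactFunctor_atiyahClassPower`);
the trace with coefficients commutes with `e_*` up to `ε♯` and the comparison, and is natural in the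
coefficients (`traceExtCoeff_comp_mk₀`, moving `e_*Ω^q_{X₀}` to `Ω^q_{X₁}` along `hodgeSheaf.comapIso`);
finally `Extⁱ(𝒪, G) → Hⁱ(X, G)` is bijective on both sides (Hartshorne III.6.3 (c),
`extToCohomology_bijective`) and `e_*` is bijective on `Ext` (`Ext.mapExactFunctor_bijective_of_isEquivalence`).
[cite: BuchweitzFlenner2003, Def. 4.1 (σ = Tr(∗ · exp(−At))) and §5 (I-semiregular); reading: σ_q is intrinsic to (X, E), hence compatible with an isomorphism of the ambient S-scheme] -/
theorem sigmaHigher_mapExactFunctor_eq_zero_iff (q : ℕ) (x : Ext.{w} E E 2) :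
    sigmaHigher (hE.pushforward_of_iso (leftIso' e)) q (x.mapExactFunctor (pushforward e.hom.left)) = 0 ↔
      sigmaHigher hE q x = 0 := by
  -- Step A: `e_*((x·ι)·At^q) = ((e_*x·ι')·At'^q)·α_q⁻¹`
  have hA : ((x.comp (Ext.mk₀ (toTwistHodgeZero E)) (add_zero 2)).comp (atiyahClassPower E q)
      (add_comm 2 q)).mapExactFunctor (pushforward e.hom.left) =
      (((x.mapExactFunctor (pushforward e.hom.left)).comp
        (Ext.mk₀ (toTwistHodgeZero ((pushforward e.hom.left).obj E))) (add_zero 2)).comp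
        (atiyahClassPower ((pushforward e.hom.left).obj E) q) (add_comm 2 q)).comp
          (Ext.mk₀ (twistHodgePushforwardIso e E q).inv) (add_zero _) := by
    rw [Ext.mapExactFunctor_comp, Ext.mapExactFunctor_comp, Ext.mapExactFunctor_mk₀,
      mapExactFunctor_atiyahClassPower, ← Ext.comp_assoc_of_second_deg_zero, Ext.comp_assoc_of_third_deg_zero
        (x.mapExactFunctor (pushforward e.hom.left)), Ext.mk₀_comp_mk₀, map_toTwistHodgeZero_comp,
      ← Ext.comp_assoc_of_third_deg_zero]
  -- Step B: the trace
  have hα : (twistHodgePushforwardIso e E q).inv ≫ (sheafHomDualPushforwardIso (leftIso' e) E (hodgeSheaf X₀ q)).hom =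
      sheafHomMap (dual ((pushforward e.hom.left).obj E)) (hodgeSheaf.comapIso e q).hom := by
    simp only [twistHodgePushforwardIso, Iso.trans_inv, Functor.mapIso_inv, Iso.symm_inv, Category.assoc,
      Iso.inv_hom_id, Category.comp_id, sheafHomFunctor_map]
  have hB := mk₀_comp_mapExactFunctor_traceExtCoeff (leftIso' e) hE (hodgeSheaf X₀ q) (q + 2)
    ((x.comp (Ext.mk₀ (toTwistHodgeZero E)) (add_zero 2)).comp (atiyahClassPower E q) (add_comm 2 q))
  rw [hA, Ext.comp_assoc_of_third_deg_zero, Ext.mk₀_comp_mk₀, hα, traceExtCoeff_comp_mk₀] at hB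
  -- Step C
  rw [sigmaHigher_apply, sigmaHigher_apply, traceCoeffToCohomology, traceCoeffToCohomology,
    AddMonoidHom.comp_apply, AddMonoidHom.comp_apply,
    ← (extToCohomology _ (q + 2)).map_zero, (extToCohomology_bijective _ (q + 2)).1.eq_iff,
    ← (extToCohomology _ (q + 2)).map_zero, (extToCohomology_bijective _ (q + 2)).1.eq_iff,
    ← Ext.comp_mk₀_eq_zero_iff _ (hodgeSheaf.comapIso e q), ← hB, Ext.mk₀_comp_eq_zero_iff,
    ← Ext.mapExactFunctor_zero (pushforward e.hom.left) (unitModule X₀.left) (hodgeSheaf X₀ q) (q + 2),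
    (Ext.mapExactFunctor_bijective_of_isEquivalence (pushforward e.hom.left) (q + 2)).1.eq_iff]

/-- **Buchweitz–Flenner `I`-semiregularity is invariant under isomorphisms of the ambient `S`-scheme**:
for `e : X₀ ≅ X₁` over `Spec S` and `E` finite locally free on `X₀`, if `(σ_q)_{q ∈ J}` is jointly injective on
`Ext²(E, E)` then it is on `Ext²(e_*E, e_*E)` («`ℰ_0` is called `I`-semiregular if the part `σ_I` of the
semiregularity map is injective» — a property of the pair `(X₀, ℰ_0)` up to isomorphism; in the tree this is
the functoriality of `sigmaHigher` in `X` that `SemiregularityHigherSigma.lean` leaves out). [cite: BuchweitzFlenner2003, Def. 4.1 (σ = Tr(∗ · exp(−At))) and §5 (I-semiregular); reading: σ_q is intrinsic to (X, E), hence compatible with an isomorphism of the ambient S-scheme] -/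
theorem IsISemiregular.of_schemeIso {J : Set ℕ} (h : IsISemiregular hE J) :
    IsISemiregular (hE.pushforward_of_iso (leftIso' e)) J := by
  intro x' hx'
  obtain ⟨x, rfl⟩ := (Ext.mapExactFunctor_bijective_of_isEquivalence (pushforward e.hom.left)
    (A := E) (F := E) 2).2 x'
  have hx : x = 0 := h x fun q hq => (sigmaHigher_mapExactFunctor_eq_zero_iff e hE q x).1 (hx' q hq)
  subst hx
  exact Ext.mapExactFunctor_zero (pushforward e.hom.left) E E 2

end Assembly

/-! ### Buchweitz–Flenner Thm. 5.1: the model rendering from the fixed-fibre rendering -/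

section BF

/-- **The Chern character along `e_*`**: `ch_p(e_* E₀) = (e⁻¹)^* ch_p(E₀)` (functoriality of `ch` under the
pull-back `(e⁻¹)^* E₀ ≅ e_* E₀` and invariance under isomorphism). [cite: Fulton1998, §15.1 (ii)] -/
theorem ChernCharacterBetti.ch_pushforward_of_iso (C : ChernCharacterBetti) {X₀ X₁ : SchemeOver ℂ} (e : X₀ ≅ X₁)
    {E₀ : X₀.left.Modules} (hE₀ : IsFiniteLocallyFree E₀) (p : ℕ) :
    C.ch X₁ ((pushforward e.hom.left).obj E₀) p = complexBetti.map e.inv (2 * p) (C.ch X₀ E₀ p) := by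
  rw [C.map_ch e.inv E₀ hE₀.isVectorBundle p, C.ch_congr (pullbackInvIsoPushforward (leftIso' e) E₀)]

/-- **Buchweitz–Flenner 2003, Thm. 5.1: the model rendering FOLLOWS from the fixed-fibre rendering.**
`BuchweitzFlenner2003_variationalHodge_ISemiregular → BuchweitzFlenner2003_variationalHodge_ISemiregular_model`:
given `E₀` on a model `e : X₀ ≅ 𝒳_{s₀}`, apply the fixed-fibre fact to `e_* E₀` on the fibre — finite locally
free (`IsFiniteLocallyFree.pushforward_of_iso`), `I`-semiregular THERE by the isomorphism-invariance of
Buchweitz–Flenner semiregularity (`IsISemiregular.of_schemeIso`), with `ch_p(e_* E₀) = (e⁻¹)^* ch_p(E₀)`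
(`ChernCharacterBetti.ch_pushforward_of_iso`). Together with the tree's converse
`BuchweitzFlenner2003_variationalHodge_ISemiregular_of_model` the two renderings are EQUIVALENT.
[cite: BuchweitzFlenner2003, §5 Thm. 5.1 and §5 (I-semiregular); §6 Example 6.2; 7.18] -/
theorem BuchweitzFlenner2003_variationalHodge_ISemiregular_model_of_fixed
    (h : BuchweitzFlenner2003_variationalHodge_ISemiregular) :
    BuchweitzFlenner2003_variationalHodge_ISemiregular_model := by
  intro C 𝒳 S π n hπ hS U hU s₀ X₀ e E₀ hE₀ I hsr hHodge
  have hE₁ : IsFiniteLocallyFree ((pushforward e.hom.left).obj E₀) := hE₀.pushforward_of_iso (leftIso' e)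
  have hsr₁ : IsISemiregular hE₁ {q | q + 1 ∈ I} := IsISemiregular.of_schemeIso e hE₀ hsr
  have hch := ChernCharacterBetti.ch_pushforward_of_iso C e hE₀
  obtain ⟨W, hWo, hW₀, hWU, hW⟩ := h C π n hπ hS hU s₀ _ hE₁ I hsr₁ fun p hp t γ => by
    rw [hch]; exact hHodge p hp t γ
  exact ⟨W, hWo, hW₀, hWU, fun p hp t γ => by rw [← hch]; exact hW p hp t γ⟩

/-- **The two renderings of Buchweitz–Flenner Thm. 5.1 are equivalent.** [cite: BuchweitzFlenner2003, §5 Thm. 5.1] -/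
theorem BuchweitzFlenner2003_variationalHodge_ISemiregular_model_iff :
    BuchweitzFlenner2003_variationalHodge_ISemiregular_model ↔
      BuchweitzFlenner2003_variationalHodge_ISemiregular :=
  ⟨BuchweitzFlenner2003_variationalHodge_ISemiregular_of_model,
    BuchweitzFlenner2003_variationalHodge_ISemiregular_model_of_fixed⟩

end BF

end Literature.AlgebraicGeometry.HodgeTheory

end
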